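import Literature.Analysis.FluidPDE.RenormalizedDiffusivityCascadeProofs
import Mathlib.Analysis.Complex.ExponentialBounds
import HarnessLib

/-!
# Armstrong–Vicol's printed scale sequence (2.8) satisfies (2.9)–(2.10)

S. Armstrong, V. Vicol, *Anomalous diffusion by fractal homogenization*, Ann. PDE **11** (2025),
Paper No. 2 = arXiv:2305.05048v3, §2.1 p. 19. [`ArmstrongVicol2025`]

`RenormalizedDiffusivityCascade.lean` packages the printed properties (2.8)–(2.10) of the length
scales as the hypothesis structure `IsScaleSequence q ε` (`ε₀ = 1`, `εₘ/εₘ₊₁ ≥ 2⁷`,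
`(1-10εₘ)εₘ^q ≤ εₘ₊₁ ≤ (1+10εₘ)εₘ^q` for `m ≥ 1`), over which Lemma 3.4 (Step 1 (3.49):
`modelDiffusivity_bounds`; Step 2: `perturbedDiffusivity_bounds`) is proved. This file proves that
the PRINTED sequence `scaleSeq Λ q` — `ε₀ := 1`, `εₘ⁻¹ := ⌈Λ^{q^m/(q-1)}⌉` ((2.8) p. 19) — has
these properties, so that those theorems are not hypothetical (`exists_isScaleSequence`,
`modelDiffusivity_bounds_scaleSeq`). The paper: "Since `ε₁ ≤ Λ^{-q/(q-1)} ≤ Λ⁻¹` and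
`⌈Λ^{q^{m+1}/(q-1)}⌉ = ⌈Λ^{q^m/(q-1)} Λ^{q^m}⌉ ≥ Λ ⌈Λ^{q^m/(q-1)}⌉`, we have that
`εₘ/εₘ₊₁ ≥ Λ, ∀ m ∈ ℕ₀`. (2.9) In particular, `εₘ ≤ Λ^{-m} ≤ 2^{-7m}`. In fact, the sequence `{εₘ}`
decreases at a super-geometric rate with `εₘ₊₁ ≃ εₘ^q`, as it is routine to check that, for every
`m ≥ 1`, `⅔ εₘ^q ≤ (1 - 10εₘ) εₘ^q ≤ εₘ₊₁ ≤ (1 + 10εₘ) εₘ^q ≤ (4/3) εₘ^q`. (2.10)" (p. 19).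

## What is proved (all theorems; no named facts)

With `xₘ := Λ^{q^m/(q-1)}` (`scaleBase`), `Nₘ := ⌈xₘ⌉`, `εₘ = 1/Nₘ` (`m ≥ 1`):
* `scaleBase_succ`: `xₘ₊₁ = xₘ^q`; `scaleBase_succ'`: `xₘ₊₁ = xₘ Λ^{q^m}`; `le_scaleBase`:
  `Λ ≤ xₘ` (`m ≥ 1`); `scaleSeq_pos`; `scaleSeq_le_inv`: `εₘ ≤ 1/Λ` (`m ≥ 1`).
* **(2.9)** `scaleSeq_ratio`: `Λ εₘ₊₁ ≤ εₘ` for every `m` (`Λ ≥ 3`, `q > 1`), and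
  `scaleSeq_le_inv_pow`: `εₘ ≤ Λ^{-m}`. (The displayed justification
  `⌈x Λ^{q^m}⌉ ≥ Λ ⌈x⌉` is not a general property of ceilings — `⌈Λ y⌉ ≤ Λ ⌈y⌉` in general —;
  the proof here uses instead `xₘ (Λ^{q^m - 1} - 1) ≥ x₁ (Λ^{q-1} - 1) ≥ Λ (log Λ)² ≥ 1`,
  `one_le_mul_rpow_mul_sub`.)
* **(2.10), lower half** `scaleSeq_succ_ge`: `(1 - 10εₘ) εₘ^q ≤ εₘ₊₁` for `m ≥ 1`, for every
  `q ≥ 1` and `Λ ≥ 1` (from `⌈xₘ^q⌉ < xₘ^q + 1 ≤ Nₘ^q + 1`).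
* **(2.10), upper half** `scaleSeq_succ_le`: `εₘ₊₁ ≤ (1 + 10εₘ) εₘ^q` for `m ≥ 1`, PROVIDED
  `1 < q < 10` and `Λ ≥ 10(q+1)/(10-q)`; the key estimate is `ceil_rpow_le`:
  `Nₘ^q ≤ (Nₘ-1)/(Nₘ-1-q) · xₘ^q` (from `Nₘ/xₘ ≤ 1 + 1/(Nₘ-1)`, `(1+u)^q ≤ e^{qu} ≤ 1/(1-qu)`,
  `one_add_rpow_le`), and `(N-1)/(N-1-q) ≤ 1 + 10/N ⟺ N ≥ 10(q+1)/(10-q)`.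
* `scaleSeq_outer`: the printed outer constants `⅔`, `4/3` (`εₘ ≤ 1/30` for `m ≥ 1`).
* `isScaleSequence_scaleSeq`: `IsScaleSequence q (scaleSeq Λ q)` for `1 < q < 10`, `Λ ≥ 2⁷`,
  `Λ ≥ 10(q+1)/(10-q)`; `isScaleSequence_scaleSeq_of_le_nine` (`q ≤ 9`: `Λ ≥ 2⁷` suffices);
  `exists_isScaleSequence` (`1 < q < 10`); with the paper's `q = qExp β` ((2.2) p. 18):
  `qExp_lt_ten` (`β > 40/39`), `ten_le_qExp` (`1 < β ≤ 40/39`), `isScaleSequence_scaleSeq_qExp`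
  (`β ∈ (40/39, 4/3)`); and `modelDiffusivity_bounds_scaleSeq` = Lemma 3.4 Step 1 (3.49) for the
  printed scales.

## Recorded, not silent: the printed constant `10` needs `q < 10`

`εₘ₊₁/εₘ^q = Nₘ^q/⌈xₘ^q⌉ ≥ (Nₘ/xₘ)^q (1 - εₘ₊₁) ≥ (1 + q θₘ/Nₘ)(1 - εₘ₊₁)` with
`θₘ := ⌈xₘ⌉ - xₘ ∈ [0,1)`, so the printed `εₘ₊₁ ≤ (1 + 10εₘ) εₘ^q` forces (up to the negligible
`εₘ₊₁`) `q θₘ ≤ 10`: for `q < 10` this is automatic (and is what we prove), for `q > 10` it is a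
Diophantine condition on the fractional parts of `Λ^{q^m/(q-1)}` that fails for most `Λ`.
Numerically (80-digit arithmetic): `q = 50` (`= qExp β` for `β = 200/199`), `Λ = 2⁷`, `m = 1`:
`x₁ = 128^{50/49} ≈ 141.32`, `ε₁ = 1/142`, `ε₂/ε₁^q ≈ 1.2697 > 1 + 10 ε₁ ≈ 1.0704`; the bound
fails at `m = 1` for 10 of the 13 values `Λ ∈ [128, 140]` and for 33 of the 40 values
`Λ ∈ [10⁴, 10⁴ + 40)` (for `Λ = 134` even `ε₂ > (4/3) ε₁^q`); for `q = 12` it fails at `m = 1`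
for 46 of 272 values `Λ ∈ [128, 400)`; for `q = 9` no failure (as proved). In terms of the paper's
`q = qExp β`, `q ≥ 10 ⟺ β ≤ 40/39` (`α = β - 1 ≤ 1/39`). The valid `q`-uniform statement is
`scaleSeq_succ_le_general`: `εₘ₊₁ ≤ (1 + 4q εₘ) εₘ^q` for `m ≥ 1` whenever `Λ ≥ 2q + 2`; with it
the only sharp use of (2.10) in the paper, (3.52) p. 44 (`|(εₘ/εₘ₋₁^q)^β - 1| ≤ C εₘ₋₁`), holds
with `C = C(β, q)` — harmless there, since the constants of Lemma 3.4 may depend on `β` (and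
`q = q(β)`), as they do in `modelDiffusivity_bounds`. (The typed `IsScaleSequence` keeps the printed
`10`; instantiating the cascade theorems for `β ≤ 40/39` would need that constant replaced by
`4q` throughout — not done here.) [cite: ArmstrongVicol2025, §2.1 (2.8)–(2.10) p. 19;
§3.3 (3.52) p. 44]

## References

* S. Armstrong, V. Vicol, *Anomalous diffusion by fractal homogenization*, Ann. PDE 11 (2025),
  no. 1, Paper No. 2 (doi:10.1007/s40818-024-00189-6; arXiv:2305.05048v3), §2.1 pp. 18–19
  ((2.2) p. 18; Λ, (2.8)–(2.11) p. 19), §3.3 Lemma 3.4 p. 43, proof (3.49)–(3.54) p. 44.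
  [`ArmstrongVicol2025`]
-/

open Real

namespace Literature.Analysis.FluidPDE

namespace ArmstrongVicol2025

section Scales

variable {Λ : ℕ} {q : ℝ} {m : ℕ}

/-- `ε₀ = 1`. [cite: ArmstrongVicol2025, §2.1 (2.8) p. 19] -/
theorem scaleSeq_zero (Λ : ℕ) (q : ℝ) : scaleSeq Λ q 0 = 1 := by
  simp [scaleSeq]

/-- `εₘ₊₁ = 1/⌈Λ^{q^(m+1)/(q-1)}⌉`. [cite: ArmstrongVicol2025, §2.1 (2.8) p. 19] -/
theorem scaleSeq_succ (Λ : ℕ) (q : ℝ) (m : ℕ) :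
    scaleSeq Λ q (m + 1) = 1 / (⌈scaleBase Λ q (m + 1)⌉₊ : ℝ) := by
  simp [scaleSeq]

/-- `xₘ = Λ^{q^m/(q-1)} > 0`. [cite: ArmstrongVicol2025, §2.1 (2.8) p. 19] -/
theorem scaleBase_pos (hΛ : 0 < Λ) : 0 < scaleBase Λ q m := by
  unfold scaleBase
  exact Real.rpow_pos_of_pos (by exact_mod_cast hΛ) _

/-- `xₘ₊₁ = xₘ^q` (`εₘ₊₁ ≃ εₘ^q`). [cite: ArmstrongVicol2025, §2.1 (2.8) p. 19] -/
theorem scaleBase_succ (Λ : ℕ) (q : ℝ) (m : ℕ) :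
    scaleBase Λ q (m + 1) = scaleBase Λ q m ^ q := by
  unfold scaleBase
  rw [← Real.rpow_mul (Nat.cast_nonneg Λ)]
  congr 1
  ring

/-- `xₘ₊₁ = xₘ · Λ^{q^m}` — the factorisation `⌈Λ^{q^(m+1)/(q-1)}⌉ = ⌈Λ^{q^m/(q-1)} Λ^{q^m}⌉`
displayed for (2.9). [cite: ArmstrongVicol2025, §2.1 (2.9) p. 19] -/
theorem scaleBase_succ' (hΛ : 0 < Λ) (hq : q ≠ 1) (m : ℕ) :
    scaleBase Λ q (m + 1) = scaleBase Λ q m * (Λ : ℝ) ^ (q ^ m) := by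
  unfold scaleBase
  rw [← Real.rpow_add (by exact_mod_cast hΛ)]
  congr 1
  have : q - 1 ≠ 0 := sub_ne_zero.2 hq
  field_simp
  ring

/-- `x₁ = Λ^{q/(q-1)} = Λ · Λ^{1/(q-1)}` ("`ε₁ ≤ Λ^{-q/(q-1)} ≤ Λ⁻¹`"). [cite: ArmstrongVicol2025, §2.1 (2.9) p. 19] -/
theorem scaleBase_one (hΛ : 0 < Λ) (hq : q ≠ 1) :
    scaleBase Λ q 1 = (Λ : ℝ) * (Λ : ℝ) ^ (1 / (q - 1)) := by
  unfold scaleBase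
  have h0 : (0 : ℝ) < Λ := by exact_mod_cast hΛ
  rw [show q ^ 1 / (q - 1) = 1 + 1 / (q - 1) by
    have : q - 1 ≠ 0 := sub_ne_zero.2 hq
    field_simp; ring]
  rw [Real.rpow_add h0, Real.rpow_one]

/-- `Λ ≤ xₘ` for `m ≥ 1` (so `εₘ ≤ Λ⁻¹`, "`ε₁ ≤ Λ^{-q/(q-1)} ≤ Λ⁻¹`"). [cite: ArmstrongVicol2025, §2.1 (2.9) p. 19] -/
theorem le_scaleBase (hΛ : 1 ≤ Λ) (hq : 1 < q) (hm : 1 ≤ m) : (Λ : ℝ) ≤ scaleBase Λ q m := by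
  unfold scaleBase
  have h1 : (1 : ℝ) ≤ Λ := by exact_mod_cast hΛ
  have hq1 : 0 < q - 1 := sub_pos.2 hq
  have hexp : (1 : ℝ) ≤ q ^ m / (q - 1) := by
    rw [le_div_iff₀ hq1]
    have : q ≤ q ^ m := by
      calc q = q ^ 1 := (pow_one q).symm
        _ ≤ q ^ m := pow_le_pow_right₀ hq.le hm
    linarith
  calc (Λ : ℝ) = (Λ : ℝ) ^ (1 : ℝ) := (Real.rpow_one _).symm
    _ ≤ (Λ : ℝ) ^ (q ^ m / (q - 1)) := Real.rpow_le_rpow_of_exponent_le h1 hexp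

/-- The ceiling `εₘ⁻¹ = ⌈xₘ⌉ ∈ ℕ` is at least `xₘ` ("we remark that `εₘ⁻¹ ∈ ℕ`"). [cite: ArmstrongVicol2025, §2.1 (2.8) p. 19] -/
theorem scaleBase_le_ceil (Λ : ℕ) (q : ℝ) (m : ℕ) :
    scaleBase Λ q m ≤ (⌈scaleBase Λ q m⌉₊ : ℝ) := Nat.le_ceil _

/-- … and less than `xₘ + 1`. [cite: ArmstrongVicol2025, §2.1 (2.8) p. 19] -/
theorem ceil_lt_scaleBase_add_one (hΛ : 0 < Λ) :
    (⌈scaleBase Λ q m⌉₊ : ℝ) < scaleBase Λ q m + 1 :=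
  Nat.ceil_lt_add_one (scaleBase_pos hΛ).le

/-- `εₘ > 0`. [cite: ArmstrongVicol2025, §2.1 (2.8) p. 19] -/
theorem scaleSeq_pos (hΛ : 0 < Λ) : ∀ m, 0 < scaleSeq Λ q m
  | 0 => by rw [scaleSeq_zero]; exact one_pos
  | m + 1 => by
    rw [scaleSeq_succ]
    have : (0 : ℝ) < (⌈scaleBase Λ q (m + 1)⌉₊ : ℝ) :=
      lt_of_lt_of_le (scaleBase_pos hΛ) (scaleBase_le_ceil Λ q (m + 1))
    positivity

/-- `εₘ ≤ 1/Λ` for `m ≥ 1` ("`ε₁ ≤ Λ^{-q/(q-1)} ≤ Λ⁻¹`" and (2.9)). [cite: ArmstrongVicol2025, §2.1 (2.9) p. 19] -/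
theorem scaleSeq_le_inv (hΛ : 1 ≤ Λ) (hq : 1 < q) (hm : 1 ≤ m) :
    scaleSeq Λ q m ≤ 1 / (Λ : ℝ) := by
  obtain ⟨k, rfl⟩ : ∃ k, m = k + 1 := ⟨m - 1, by omega⟩
  rw [scaleSeq_succ]
  have hΛ0 : (0 : ℝ) < Λ := by exact_mod_cast hΛ
  exact one_div_le_one_div_of_le hΛ0
    ((le_scaleBase hΛ hq hm).trans (scaleBase_le_ceil Λ q (k + 1)))

/-! #### An elementary exponential bound -/

/-- `(1+u)^q ≤ 1/(1 - q u)` for `u ≥ 0`, `q ≥ 0`, `q u < 1`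
(via `1 + u ≤ e^u` and `e^{qu} (1 - qu) ≤ e^{qu} e^{-qu} = 1`); elementary helper for (2.10).
[cite: ArmstrongVicol2025, §2.1 (2.10) p. 19 — "routine to check", the check] -/
theorem one_add_rpow_le {u q : ℝ} (hu : 0 ≤ u) (hq : 0 ≤ q) (hqu : q * u < 1) :
    (1 + u) ^ q ≤ 1 / (1 - q * u) := by
  have h1 : (1 + u) ^ q ≤ Real.exp (q * u) := by
    calc (1 + u) ^ q ≤ (Real.exp u) ^ q :=
          Real.rpow_le_rpow (by linarith) (by linarith [Real.add_one_le_exp u]) hq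
      _ = Real.exp (q * u) := by rw [← Real.exp_mul, mul_comm]
  have h2 : Real.exp (q * u) ≤ 1 / (1 - q * u) := by
    have hpos : 0 < 1 - q * u := by linarith
    rw [le_div_iff₀ hpos]
    have h3 : -(q * u) + 1 ≤ Real.exp (-(q * u)) := Real.add_one_le_exp _
    calc Real.exp (q * u) * (1 - q * u) ≤ Real.exp (q * u) * Real.exp (-(q * u)) := by
          apply mul_le_mul_of_nonneg_left _ (Real.exp_pos _).le
          linarith
      _ = 1 := by rw [← Real.exp_add, add_neg_cancel, Real.exp_zero]
  exact h1.trans h2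

/-- The key ceiling estimate behind the upper half of (2.10): for `x > 0` with
`N := ⌈x⌉` and `q ≥ 0`, `q < N - 1`, one has `N^q ≤ (N-1)/(N-1-q) · x^q`.
[cite: ArmstrongVicol2025, §2.1 (2.10) p. 19 — "routine to check", the check] -/
theorem ceil_rpow_le {x q : ℝ} (hx : 0 < x) (hq : 0 ≤ q) (hN : q + 1 < (⌈x⌉₊ : ℝ)) :
    (⌈x⌉₊ : ℝ) ^ q ≤ ((⌈x⌉₊ : ℝ) - 1) / ((⌈x⌉₊ : ℝ) - 1 - q) * x ^ q := by
  set N : ℝ := (⌈x⌉₊ : ℝ) with hNdef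
  have hxN : x ≤ N := Nat.le_ceil _
  have hNx : N < x + 1 := Nat.ceil_lt_add_one hx.le
  have hN1 : 0 < N - 1 := by linarith
  have hxq : 0 < x ^ q := Real.rpow_pos_of_pos hx _
  -- N^q = (N/x)^q x^q
  have hsplit : N ^ q = (N / x) ^ q * x ^ q := by
    rw [← Real.mul_rpow (by positivity) hx.le, div_mul_cancel₀ _ hx.ne']
  rw [hsplit]
  apply mul_le_mul_of_nonneg_right _ hxq.le
  -- N/x ≤ 1 + 1/(N-1)
  have hratio : N / x ≤ 1 + 1 / (N - 1) := by
    rw [div_le_iff₀ hx]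
    have : 1 + 1 / (N - 1) = N / (N - 1) := by field_simp; ring
    rw [this, div_mul_eq_mul_div, le_div_iff₀ hN1]
    nlinarith
  have hu : 0 ≤ 1 / (N - 1) := by positivity
  have hqu : q * (1 / (N - 1)) < 1 := by
    rw [mul_one_div, div_lt_one hN1]; linarith
  calc (N / x) ^ q ≤ (1 + 1 / (N - 1)) ^ q := Real.rpow_le_rpow (by positivity) hratio hq
    _ ≤ 1 / (1 - q * (1 / (N - 1))) := one_add_rpow_le hu hq hqu
    _ = (N - 1) / (N - 1 - q) := by
        have : N - 1 - q ≠ 0 := by linarith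
        field_simp

/-! #### (2.9): the minimal scale separation -/

/-- An auxiliary lower bound: for `Λ ≥ 3` and `s > 0`, `Λ · Λ^{1/s} · (Λ^s - 1) ≥ 1`
(from `Λ^{1/s} ≥ 1 + (log Λ)/s`, `Λ^s - 1 ≥ s log Λ` and `log Λ ≥ 1`); with `s = q - 1` this is
`x₁ (Λ^{q-1} - 1) ≥ 1`, the inequality that makes (2.9) true.
[cite: ArmstrongVicol2025, §2.1 (2.9) p. 19 — the check] -/
theorem one_le_mul_rpow_mul_sub {L s : ℝ} (hΛ : (3 : ℝ) ≤ L) (hs : 0 < s) :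
    1 ≤ L * L ^ (1 / s) * (L ^ s - 1) := by
  have hL0 : 0 < L := by linarith
  have hlog : 1 ≤ Real.log L := by
    rw [Real.le_log_iff_exp_le hL0]
    have := Real.exp_one_lt_three
    linarith
  have hA : 1 + Real.log L / s ≤ L ^ (1 / s) := by
    rw [Real.rpow_def_of_pos hL0, div_eq_mul_one_div]
    have := Real.add_one_le_exp (Real.log L * (1 / s))
    linarith
  have hB : s * Real.log L ≤ L ^ s - 1 := by
    rw [Real.rpow_def_of_pos hL0]
    have := Real.add_one_le_exp (Real.log L * s)
    linarith [mul_comm s (Real.log L)]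
  have hA0 : 0 ≤ 1 + Real.log L / s := by positivity
  have hB0 : 0 ≤ s * Real.log L := by positivity
  calc (1 : ℝ) ≤ 3 * (1 * (s * 0 + 1 * 1)) := by norm_num
    _ ≤ L * ((1 + Real.log L / s) * (s * Real.log L)) := by
        have h1 : (1 + Real.log L / s) * (s * Real.log L)
            = s * Real.log L + Real.log L * Real.log L := by
          field_simp
        rw [h1]
        have h2 : (1 : ℝ) ≤ Real.log L * Real.log L := by nlinarith
        nlinarith
    _ ≤ L * (L ^ (1 / s) * (L ^ s - 1)) := by
        apply mul_le_mul_of_nonneg_left _ hL0.le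
        exact mul_le_mul hA hB hB0 (le_trans hA0 hA)
    _ = L * L ^ (1 / s) * (L ^ s - 1) := by ring

/-- **(2.9)** `εₘ/εₘ₊₁ ≥ Λ`, i.e. `Λ εₘ₊₁ ≤ εₘ`, for every `m` (here for `Λ ≥ 3`, `q > 1`).
[cite: ArmstrongVicol2025, §2.1 (2.9) p. 19] -/
theorem scaleSeq_ratio (hΛ : 3 ≤ Λ) (hq : 1 < q) (m : ℕ) :
    (Λ : ℝ) * scaleSeq Λ q (m + 1) ≤ scaleSeq Λ q m := by
  have hΛ0 : 0 < Λ := by omega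
  have hΛr : (0 : ℝ) < Λ := by exact_mod_cast hΛ0
  have hΛ3 : (3 : ℝ) ≤ Λ := by exact_mod_cast hΛ
  have hq1 : q ≠ 1 := ne_of_gt hq
  cases m with
  | zero =>
    -- Λ / N₁ ≤ 1 since Λ ≤ x₁ ≤ N₁
    rw [scaleSeq_zero, scaleSeq_succ, mul_one_div, div_le_one
      (lt_of_lt_of_le (scaleBase_pos hΛ0) (scaleBase_le_ceil Λ q 1))]
    exact (le_scaleBase (by omega) hq le_rfl).trans (scaleBase_le_ceil Λ q 1)
  | succ k =>
    rw [scaleSeq_succ, scaleSeq_succ, mul_one_div]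
    set x : ℝ := scaleBase Λ q (k + 1) with hxdef
    have hx0 : 0 < x := scaleBase_pos hΛ0
    have hN0 : 0 < (⌈x⌉₊ : ℝ) := lt_of_lt_of_le hx0 (Nat.le_ceil _)
    have hN' : 0 < (⌈scaleBase Λ q (k + 1 + 1)⌉₊ : ℝ) :=
      lt_of_lt_of_le (scaleBase_pos hΛ0) (Nat.le_ceil _)
    rw [div_le_div_iff₀ hN' hN0, one_mul]
    -- Λ ⌈x⌉ ≤ ⌈x_{k+2}⌉ ; use ⌈x⌉ < x + 1 and x_{k+2} = x Λ^{q^{k+1}} ≤ ⌈x_{k+2}⌉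
    have hNx : (⌈x⌉₊ : ℝ) < x + 1 := Nat.ceil_lt_add_one hx0.le
    have hsucc : scaleBase Λ q (k + 1 + 1) = x * (Λ : ℝ) ^ (q ^ (k + 1)) :=
      scaleBase_succ' hΛ0 hq1 (k + 1)
    have hceil2 : x * (Λ : ℝ) ^ (q ^ (k + 1)) ≤ (⌈scaleBase Λ q (k + 1 + 1)⌉₊ : ℝ) := by
      rw [← hsucc]; exact Nat.le_ceil _
    -- main inequality: Λ (x + 1) ≤ x Λ^{q^{k+1}}, i.e. 1 ≤ x (Λ^{q^{k+1}-1} - 1)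
    have hpow : (Λ : ℝ) ^ (q ^ (k + 1)) = Λ * (Λ : ℝ) ^ (q ^ (k + 1) - 1) := by
      rw [show q ^ (k + 1) = 1 + (q ^ (k + 1) - 1) by ring, Real.rpow_add hΛr, Real.rpow_one]
      ring_nf
    -- lower bounds: x ≥ x₁ = Λ Λ^{1/(q-1)} and Λ^{q^{k+1}-1} ≥ Λ^{q-1}
    have hs : 0 < q - 1 := sub_pos.2 hq
    have hx1 : (Λ : ℝ) * (Λ : ℝ) ^ (1 / (q - 1)) ≤ x := by
      rw [← scaleBase_one hΛ0 hq1, hxdef]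
      unfold scaleBase
      apply Real.rpow_le_rpow_of_exponent_le (by linarith)
      apply div_le_div_of_nonneg_right _ hs.le
      calc q ^ 1 = q := pow_one q
        _ ≤ q ^ (k + 1) := by
            calc q = q ^ 1 := (pow_one q).symm
              _ ≤ q ^ (k + 1) := pow_le_pow_right₀ hq.le (by omega)
    have hexp : (Λ : ℝ) ^ (q - 1) ≤ (Λ : ℝ) ^ (q ^ (k + 1) - 1) := by
      apply Real.rpow_le_rpow_of_exponent_le (by linarith)
      have : q ≤ q ^ (k + 1) := by
        calc q = q ^ 1 := (pow_one q).symm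
          _ ≤ q ^ (k + 1) := pow_le_pow_right₀ hq.le (by omega)
      linarith
    have hkey : 1 ≤ x * ((Λ : ℝ) ^ (q ^ (k + 1) - 1) - 1) := by
      have h1 := one_le_mul_rpow_mul_sub hΛ3 hs
      have hpos1 : 0 ≤ (Λ : ℝ) ^ (q - 1) - 1 := by
        have : (1 : ℝ) ≤ (Λ : ℝ) ^ (q - 1) := Real.one_le_rpow (by linarith) hs.le
        linarith
      calc (1 : ℝ) ≤ Λ * (Λ : ℝ) ^ (1 / (q - 1)) * ((Λ : ℝ) ^ (q - 1) - 1) := h1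
        _ ≤ x * ((Λ : ℝ) ^ (q ^ (k + 1) - 1) - 1) :=
            mul_le_mul hx1 (by linarith) hpos1 hx0.le
    calc (Λ : ℝ) * (⌈x⌉₊ : ℝ) ≤ Λ * (x + 1) := by
          apply mul_le_mul_of_nonneg_left hNx.le hΛr.le
      _ ≤ x * (Λ : ℝ) ^ (q ^ (k + 1)) := by rw [hpow]; nlinarith
      _ ≤ _ := hceil2

/-- `εₘ ≤ Λ^{-m}` ("In particular, `εₘ ≤ Λ^{-m} ≤ 2^{-7m}`"). [cite: ArmstrongVicol2025, §2.1 (2.9) p. 19] -/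
theorem scaleSeq_le_inv_pow (hΛ : 3 ≤ Λ) (hq : 1 < q) :
    ∀ m, scaleSeq Λ q m ≤ ((Λ : ℝ)⁻¹) ^ m
  | 0 => by rw [scaleSeq_zero, pow_zero]
  | m + 1 => by
    have hΛr : (0 : ℝ) < Λ := by exact_mod_cast (show 0 < Λ by omega)
    have h := scaleSeq_ratio hΛ hq m
    have ih := scaleSeq_le_inv_pow hΛ hq m
    rw [pow_succ]
    calc scaleSeq Λ q (m + 1) = ((Λ : ℝ) * scaleSeq Λ q (m + 1)) * (Λ : ℝ)⁻¹ := by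
          field_simp
      _ ≤ scaleSeq Λ q m * (Λ : ℝ)⁻¹ := by
          apply mul_le_mul_of_nonneg_right h (by positivity)
      _ ≤ ((Λ : ℝ)⁻¹) ^ m * (Λ : ℝ)⁻¹ := by
          apply mul_le_mul_of_nonneg_right ih (by positivity)

/-! #### (2.10), lower half: always -/

/-- Lower half of **(2.10)**: `(1 - 10 εₘ) εₘ^q ≤ εₘ₊₁` for `m ≥ 1` (any `q ≥ 1`, any `Λ ≥ 1`;
from `εₘ₊₁⁻¹ = ⌈xₘ^q⌉ < xₘ^q + 1 ≤ εₘ^{-q} + 1`). [cite: ArmstrongVicol2025, §2.1 (2.10) p. 19] -/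
theorem scaleSeq_succ_ge (hΛ : 1 ≤ Λ) (hq : 1 ≤ q) (hm : 1 ≤ m) :
    (1 - 10 * scaleSeq Λ q m) * scaleSeq Λ q m ^ q ≤ scaleSeq Λ q (m + 1) := by
  obtain ⟨k, rfl⟩ : ∃ k, m = k + 1 := ⟨m - 1, by omega⟩
  have hΛ0 : 0 < Λ := by omega
  rw [scaleSeq_succ, scaleSeq_succ]
  set x : ℝ := scaleBase Λ q (k + 1) with hxdef
  set N : ℝ := (⌈x⌉₊ : ℝ) with hNdef
  have hx0 : 0 < x := scaleBase_pos hΛ0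
  have hxN : x ≤ N := Nat.le_ceil _
  have hN0 : 0 < N := lt_of_lt_of_le hx0 hxN
  have hN1 : 1 ≤ N := by
    have : (1 : ℕ) ≤ ⌈x⌉₊ := Nat.one_le_iff_ne_zero.2 (Nat.pos_iff_ne_zero.1 (Nat.ceil_pos.2 hx0))
    rw [hNdef]
    exact_mod_cast this
  have hsucc : scaleBase Λ q (k + 1 + 1) = x ^ q := scaleBase_succ Λ q (k + 1)
  set N' : ℝ := (⌈scaleBase Λ q (k + 1 + 1)⌉₊ : ℝ) with hN'def
  have hxq0 : 0 < x ^ q := Real.rpow_pos_of_pos hx0 _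
  have hN'0 : 0 < N' := lt_of_lt_of_le (by rw [hsucc]; exact hxq0) (Nat.le_ceil _)
  have hN'lt : N' < x ^ q + 1 := by
    rw [hN'def, hsucc]; exact Nat.ceil_lt_add_one hxq0.le
  have hxqN : x ^ q ≤ N ^ q := Real.rpow_le_rpow hx0.le hxN (by linarith)
  have hNq : N ≤ N ^ q := by
    calc N = N ^ (1 : ℝ) := (Real.rpow_one N).symm
      _ ≤ N ^ q := Real.rpow_le_rpow_of_exponent_le hN1 hq
  have hNq0 : 0 < N ^ q := Real.rpow_pos_of_pos hN0 _
  rw [Real.div_rpow zero_le_one hN0.le, Real.one_rpow]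
  by_cases h10 : 1 - 10 * (1 / N) ≤ 0
  · calc (1 - 10 * (1 / N)) * (1 / N ^ q) ≤ 0 :=
          mul_nonpos_of_nonpos_of_nonneg h10 (by positivity)
      _ ≤ 1 / N' := by positivity
  · rw [not_le] at h10
    rw [mul_one_div, div_le_div_iff₀ hNq0 hN'0, one_mul]
    -- (1 - 10/N) N' ≤ N^q
    calc (1 - 10 * (1 / N)) * N' ≤ (1 - 10 * (1 / N)) * (N ^ q + 1) := by
          apply mul_le_mul_of_nonneg_left _ h10.le
          linarith
      _ = N ^ q + 1 - 10 * (N ^ q / N) - 10 / N := by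
          field_simp
          ring
      _ ≤ N ^ q := by
          have : 1 ≤ N ^ q / N := by rw [le_div_iff₀ hN0]; linarith
          have : 0 < 10 / N := by positivity
          linarith

/-! #### (2.10), upper half: needs `q < 10` -/

/-- Upper half of **(2.10)** in its printed form, `εₘ₊₁ ≤ (1 + 10 εₘ) εₘ^q` for `m ≥ 1`,
under `0 ≤ q < 10` and `Λ ≥ 10(q+1)/(10-q)`. [cite: ArmstrongVicol2025, §2.1 (2.10) p. 19] -/
theorem scaleSeq_succ_le (hq1 : 1 < q) (hq10 : q < 10)
    (hΛq : 10 * (q + 1) / (10 - q) ≤ (Λ : ℝ)) (hm : 1 ≤ m) :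
    scaleSeq Λ q (m + 1) ≤ (1 + 10 * scaleSeq Λ q m) * scaleSeq Λ q m ^ q := by
  obtain ⟨k, rfl⟩ : ∃ k, m = k + 1 := ⟨m - 1, by omega⟩
  have hq0 : 0 ≤ q := by linarith
  have h10q : 0 < 10 - q := by linarith
  have hΛq' : q + 1 < (Λ : ℝ) := by
    have : q + 1 < 10 * (q + 1) / (10 - q) := by
      rw [lt_div_iff₀ h10q]; nlinarith
    linarith
  have hΛ1 : 1 ≤ Λ := by
    have : (1 : ℝ) < Λ := by linarith
    exact_mod_cast this.le
  have hΛ0 : 0 < Λ := by omega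
  rw [scaleSeq_succ, scaleSeq_succ]
  set x : ℝ := scaleBase Λ q (k + 1) with hxdef
  set N : ℝ := (⌈x⌉₊ : ℝ) with hNdef
  have hx0 : 0 < x := scaleBase_pos hΛ0
  have hxN : x ≤ N := Nat.le_ceil _
  have hΛx : (Λ : ℝ) ≤ x := le_scaleBase hΛ1 hq1 (by omega)
  have hN0 : 0 < N := lt_of_lt_of_le hx0 hxN
  have hqN : q + 1 < N := by linarith
  have hsucc : scaleBase Λ q (k + 1 + 1) = x ^ q := scaleBase_succ Λ q (k + 1)
  set N' : ℝ := (⌈scaleBase Λ q (k + 1 + 1)⌉₊ : ℝ) with hN'def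
  have hxq0 : 0 < x ^ q := Real.rpow_pos_of_pos hx0 _
  have hxqN' : x ^ q ≤ N' := by rw [hN'def, hsucc]; exact Nat.le_ceil _
  have hN'0 : 0 < N' := lt_of_lt_of_le hxq0 hxqN'
  have hNq0 : 0 < N ^ q := Real.rpow_pos_of_pos hN0 _
  rw [Real.div_rpow zero_le_one hN0.le, Real.one_rpow, mul_one_div,
    div_le_div_iff₀ hN'0 hNq0, one_mul]
  -- N^q ≤ (1 + 10/N) N'
  have hkey : N ^ q ≤ (N - 1) / (N - 1 - q) * x ^ q := ceil_rpow_le hx0 hq0 hqN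
  have hfac : (N - 1) / (N - 1 - q) ≤ 1 + 10 * (1 / N) := by
    have hden : 0 < N - 1 - q := by linarith
    rw [div_le_iff₀ hden]
    have hNlow : 10 * (q + 1) / (10 - q) ≤ N := hΛq.trans (hΛx.trans hxN)
    rw [div_le_iff₀ h10q] at hNlow
    have : (1 + 10 * (1 / N)) * (N - 1 - q) = N - 1 - q + 10 - 10 * (1 + q) / N := by
      field_simp
      ring
    rw [this]
    have h2 : 10 * (1 + q) / N ≤ 10 - q := by
      rw [div_le_iff₀ hN0]; linarith
    linarith
  calc N ^ q ≤ (N - 1) / (N - 1 - q) * x ^ q := hkey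
    _ ≤ (1 + 10 * (1 / N)) * x ^ q := mul_le_mul_of_nonneg_right hfac hxq0.le
    _ ≤ (1 + 10 * (1 / N)) * N' := mul_le_mul_of_nonneg_left hxqN' (by positivity)

/-- The `q`-uniform replacement of the upper half of (2.10) (valid for every `q > 1`, in
particular for `q ≥ 10` where the printed constant `10` fails, see the module docstring): for
`Λ ≥ 2q + 2` and `m ≥ 1`, `εₘ₊₁ ≤ (1 + 4 q εₘ) εₘ^q`.
[cite: ArmstrongVicol2025, §2.1 (2.10) p. 19 — corrected constant] -/
theorem scaleSeq_succ_le_general (hq1 : 1 < q) (hΛq : 2 * q + 2 ≤ (Λ : ℝ)) (hm : 1 ≤ m) :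
    scaleSeq Λ q (m + 1) ≤ (1 + 4 * q * scaleSeq Λ q m) * scaleSeq Λ q m ^ q := by
  obtain ⟨k, rfl⟩ : ∃ k, m = k + 1 := ⟨m - 1, by omega⟩
  have hq0 : 0 ≤ q := by linarith
  have hΛ1 : 1 ≤ Λ := by
    have : (1 : ℝ) < Λ := by linarith
    exact_mod_cast this.le
  have hΛ0 : 0 < Λ := by omega
  rw [scaleSeq_succ, scaleSeq_succ]
  set x : ℝ := scaleBase Λ q (k + 1) with hxdef
  set N : ℝ := (⌈x⌉₊ : ℝ) with hNdef
  have hx0 : 0 < x := scaleBase_pos hΛ0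
  have hxN : x ≤ N := Nat.le_ceil _
  have hΛx : (Λ : ℝ) ≤ x := le_scaleBase hΛ1 hq1 (by omega)
  have hN0 : 0 < N := lt_of_lt_of_le hx0 hxN
  have hqN : 2 * q + 2 ≤ N := hΛq.trans (hΛx.trans hxN)
  have hqN' : q + 1 < N := by linarith
  have hsucc : scaleBase Λ q (k + 1 + 1) = x ^ q := scaleBase_succ Λ q (k + 1)
  set N' : ℝ := (⌈scaleBase Λ q (k + 1 + 1)⌉₊ : ℝ) with hN'def
  have hxq0 : 0 < x ^ q := Real.rpow_pos_of_pos hx0 _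
  have hxqN' : x ^ q ≤ N' := by rw [hN'def, hsucc]; exact Nat.le_ceil _
  have hN'0 : 0 < N' := lt_of_lt_of_le hxq0 hxqN'
  have hNq0 : 0 < N ^ q := Real.rpow_pos_of_pos hN0 _
  rw [Real.div_rpow zero_le_one hN0.le, Real.one_rpow, mul_one_div,
    div_le_div_iff₀ hN'0 hNq0, one_mul]
  have hkey : N ^ q ≤ (N - 1) / (N - 1 - q) * x ^ q := ceil_rpow_le hx0 hq0 hqN'
  have hfac : (N - 1) / (N - 1 - q) ≤ 1 + 4 * q * (1 / N) := by
    have hden : 0 < N - 1 - q := by linarith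
    rw [div_le_iff₀ hden]
    have : (1 + 4 * q * (1 / N)) * (N - 1 - q) = N - 1 - q + 4 * q - 4 * q * (1 + q) / N := by
      field_simp
      ring
    rw [this]
    have h2 : 4 * q * (1 + q) / N ≤ 2 * q := by
      rw [div_le_iff₀ hN0]; nlinarith
    linarith
  calc N ^ q ≤ (N - 1) / (N - 1 - q) * x ^ q := hkey
    _ ≤ (1 + 4 * q * (1 / N)) * x ^ q := mul_le_mul_of_nonneg_right hfac hxq0.le
    _ ≤ (1 + 4 * q * (1 / N)) * N' := mul_le_mul_of_nonneg_left hxqN' (by positivity)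

/-! #### The printed scale sequence IS a scale sequence (for `q < 10`) -/

/-- **(2.8) ⟹ (2.9)–(2.10)**: for `1 < q < 10` and an integer `Λ ≥ max{2⁷, 10(q+1)/(10-q)}`, the
printed length scales `ε₀ = 1`, `εₘ = ⌈Λ^{q^m/(q-1)}⌉⁻¹` form an `IsScaleSequence q`:
positive, `ε₀ = 1`, `2⁷ εₘ₊₁ ≤ Λ εₘ₊₁ ≤ εₘ` ((2.9)), and
`(1 - 10εₘ) εₘ^q ≤ εₘ₊₁ ≤ (1 + 10εₘ) εₘ^q` for `m ≥ 1` ((2.10)). (The paper takes any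
`Λ ∈ ℕ ∩ [2⁷, ∞)`, "chosen to depend only on `β`" at the end of §5, and any `q > 1`; on the
restriction `q < 10` see the module docstring.)
[cite: ArmstrongVicol2025, §2.1 (2.8)–(2.10) p. 19] -/
theorem isScaleSequence_scaleSeq (hq1 : 1 < q) (hq10 : q < 10) (hΛ : 2 ^ 7 ≤ Λ)
    (hΛq : 10 * (q + 1) / (10 - q) ≤ (Λ : ℝ)) : IsScaleSequence q (scaleSeq Λ q) where
  pos := scaleSeq_pos (by omega)
  zero := scaleSeq_zero Λ q
  ratio m := by
    have hΛr : (2 : ℝ) ^ 7 ≤ Λ := by exact_mod_cast hΛ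
    calc (2 : ℝ) ^ 7 * scaleSeq Λ q (m + 1) ≤ Λ * scaleSeq Λ q (m + 1) :=
          mul_le_mul_of_nonneg_right hΛr (scaleSeq_pos (by omega) _).le
      _ ≤ scaleSeq Λ q m := scaleSeq_ratio (by omega) hq1 m
  superGeometric m hm :=
    ⟨scaleSeq_succ_ge (by omega) hq1.le hm, scaleSeq_succ_le hq1 hq10 hΛq hm⟩

/-- For `q ≤ 9` the size condition `Λ ≥ 10(q+1)/(10-q)` is implied by the paper's `Λ ≥ 2⁷`:
the printed scales form an `IsScaleSequence q` for every `Λ ∈ ℕ ∩ [2⁷, ∞)`.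
[cite: ArmstrongVicol2025, §2.1 (2.8)–(2.10) p. 19] -/
theorem isScaleSequence_scaleSeq_of_le_nine (hq1 : 1 < q) (hq9 : q ≤ 9) (hΛ : 2 ^ 7 ≤ Λ) :
    IsScaleSequence q (scaleSeq Λ q) := by
  apply isScaleSequence_scaleSeq hq1 (by linarith) hΛ
  have hΛr : (2 : ℝ) ^ 7 ≤ Λ := by exact_mod_cast hΛ
  have h10q : 0 < 10 - q := by linarith
  rw [div_le_iff₀ h10q]
  nlinarith

/-- Non-vacuity of `IsScaleSequence q` for every `q ∈ (1, 10)` (witness: the printed scales (2.8)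
with `Λ = max{2⁷, ⌈10(q+1)/(10-q)⌉}`). [cite: ArmstrongVicol2025, §2.1 (2.8)–(2.10) p. 19] -/
theorem exists_isScaleSequence (hq1 : 1 < q) (hq10 : q < 10) :
    ∃ ε : ℕ → ℝ, IsScaleSequence q ε := by
  obtain ⟨Λ, hΛ⟩ := exists_nat_ge (max (128 : ℝ) (10 * (q + 1) / (10 - q)))
  have h128 : (128 : ℝ) ≤ Λ := (le_max_left _ _).trans hΛ
  have h128' : 128 ≤ Λ := by exact_mod_cast h128
  refine ⟨scaleSeq Λ q, isScaleSequence_scaleSeq hq1 hq10 ?_ ((le_max_right _ _).trans hΛ)⟩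
  rw [show (2 : ℕ) ^ 7 = 128 by norm_num]
  exact h128'

/-- `qExp β < 10` as soon as `β > 40/39`: the range of `β` in which the printed constant `10` of
(2.10) is valid for `q = qExp β`. [cite: ArmstrongVicol2025, §2.1 (2.2) p. 18, (2.10) p. 19] -/
theorem qExp_lt_ten {β : ℝ} (h1 : 40 / 39 < β) : qExp β < 10 := by
  unfold qExp
  have hb : 0 < 2 * (β - 1) := by linarith
  have : (2 - β) / (2 * (β - 1)) < 19 := by rw [div_lt_iff₀ hb]; linarith
  linarith

/-- Conversely `qExp β ≥ 10` for `1 < β ≤ 40/39` (where the printed constant `10` of (2.10) fails for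
most `Λ`, see the module docstring). [cite: ArmstrongVicol2025, §2.1 (2.2) p. 18, (2.10) p. 19] -/
theorem ten_le_qExp {β : ℝ} (h0 : 1 < β) (h1 : β ≤ 40 / 39) : 10 ≤ qExp β := by
  unfold qExp
  have hb : 0 < 2 * (β - 1) := by linarith
  have : 19 ≤ (2 - β) / (2 * (β - 1)) := by rw [le_div_iff₀ hb]; linarith
  linarith

/-- The printed scale sequence with Armstrong–Vicol's own exponent `q = qExp β` ((2.2)) is a scale
sequence for `β ∈ (40/39, 4/3)` and `Λ ≥ max{2⁷, 10(q+1)/(10-q)}`.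
[cite: ArmstrongVicol2025, §2.1 (2.2) p. 18, (2.8)–(2.10) p. 19] -/
theorem isScaleSequence_scaleSeq_qExp {β : ℝ} (h1 : 40 / 39 < β) (h2 : β < 4 / 3)
    (hΛ : 2 ^ 7 ≤ Λ) (hΛq : 10 * (qExp β + 1) / (10 - qExp β) ≤ (Λ : ℝ)) :
    IsScaleSequence (qExp β) (scaleSeq Λ (qExp β)) :=
  isScaleSequence_scaleSeq (one_lt_qExp (by linarith) h2) (qExp_lt_ten h1) hΛ hΛq

/-- The printed outer constants of (2.10): for `m ≥ 1` (where `εₘ ≤ 1/Λ ≤ 1/30`),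
`(2/3) εₘ^q ≤ (1 - 10 εₘ) εₘ^q` and `(1 + 10 εₘ) εₘ^q ≤ (4/3) εₘ^q`.
[cite: ArmstrongVicol2025, §2.1 (2.10) p. 19] -/
theorem scaleSeq_outer (hΛ : 30 ≤ Λ) (hq : 1 < q) (hm : 1 ≤ m) :
    2 / 3 * scaleSeq Λ q m ^ q ≤ (1 - 10 * scaleSeq Λ q m) * scaleSeq Λ q m ^ q ∧
      (1 + 10 * scaleSeq Λ q m) * scaleSeq Λ q m ^ q ≤ 4 / 3 * scaleSeq Λ q m ^ q := by
  have hε := scaleSeq_le_inv (Λ := Λ) (by omega) hq hm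
  have hΛr : (30 : ℝ) ≤ Λ := by exact_mod_cast hΛ
  have h30 : scaleSeq Λ q m ≤ 1 / 30 := hε.trans (one_div_le_one_div_of_le (by norm_num) hΛr)
  have hpos : 0 ≤ scaleSeq Λ q m ^ q := (Real.rpow_pos_of_pos (scaleSeq_pos (by omega) m) _).le
  constructor <;> nlinarith

/-- **Lemma 3.4, Step 1 (3.49), for the printed scale sequence (2.8)**: the non-hypothetical form of
`modelDiffusivity_bounds` — for `β > 0`, `q ∈ (1, 10)` there are `0 < c ≤ C` (depending only on
`β`, `q`) such that for every `Λ ≥ max{2⁷, 10(q+1)/(10-q)}`, every critical scale `M` and every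
`κ` in the permissible window (3.44), the model cascade (3.47) over `εₘ = ⌈Λ^{q^m/(q-1)}⌉⁻¹`
obeys `c aₘ εₘ^{2+γ} ≤ κ'ₘ ≤ C aₘ εₘ^{2+γ}` for `1 ≤ m ≤ M - 1`.
[cite: ArmstrongVicol2025, §2.1 (2.8) p. 19; Lemma 3.4 p. 43, proof Step 1 (3.49) p. 44] -/
theorem modelDiffusivity_bounds_scaleSeq {β q : ℝ} (hβ : 0 < β) (hq : 1 < q) (hq10 : q < 10) :
    ∃ c C : ℝ, 0 < c ∧ c ≤ C ∧
      ∀ Λ : ℕ, 2 ^ 7 ≤ Λ → 10 * (q + 1) / (10 - q) ≤ (Λ : ℝ) → ∀ (M : ℕ) (κ : ℝ),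
        scaleSeq Λ q M ^ (2 * β / (q + 1)) / 2 ≤ κ → κ ≤ 2 * scaleSeq Λ q M ^ (2 * β / (q + 1)) →
        ∀ m : ℕ, 1 ≤ m → m < M →
          c * (scaleSeq Λ q m ^ (β - 2) * scaleSeq Λ q m ^ (2 + gammaExp β q)) ≤
              modelDiffusivity (fun n => scaleSeq Λ q n ^ (β - 2)) (scaleSeq Λ q) M κ m ∧
            modelDiffusivity (fun n => scaleSeq Λ q n ^ (β - 2)) (scaleSeq Λ q) M κ m ≤
              C * (scaleSeq Λ q m ^ (β - 2) * scaleSeq Λ q m ^ (2 + gammaExp β q)) := by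
  obtain ⟨c, C, hc, hcC, h⟩ := modelDiffusivity_bounds hβ hq
  exact ⟨c, C, hc, hcC, fun Λ hΛ hΛq => h _ (isScaleSequence_scaleSeq hq hq10 hΛ hΛq)⟩

end Scales

end ArmstrongVicol2025

end Literature.Analysis.FluidPDE
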